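import Literature.AnabelianGeometry.AbsoluteAnabelian.AbsTopIII.Thm19TaggedStatements
import Literature.AnabelianGeometry.AbsoluteAnabelian.AbsTopIII.Thm19KummerTowerBridgeProofs
import HarnessLib

/-!
# [AbsTopIII] Thm. 1.9 (d)(e) for geometric (tagged) systems at every law-abiding model: the closers of
# `Thm19dTagged` / `Thm19eTagged` from the named facts alone (proof-only)

Mochizuki, *Topics in Absolute Anabelian Geometry III*, §1, Theorem 1.9 (d)(e), manuscript pp. 37–38 (lit
key `paper:url-5493eb38cbb7`).

Sub-DAG `plan/L4/SUBDAG-AbsTopIII-Thm19.md` rows r8–r11 (abc-iut-w5-d213).  NON-VACUOUS closers (their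
hypotheses are abc-iut-L4-t1's named facts only — no per-system hypothesis): for every `DescentKummerModel` satisfying `Prop_1_8_i/ii`, `Prop_1_6_i`, `Prop_1_6_iii_units/ker`,
`Rmk_1_5_4_i`, Thm. 1.9 (d) holds for every
tagged system (`thm19dTagged_of_facts`, from `exists_nfTower_of_tags` and the tower theorems); the (e)-closer
`PlacedKummerModelV2.thm19eTagged_of_facts` lives with the (e)-bridge assembly (`Thm19DictionaryBridge.lean`, over the
v2 law structures of abc-iut-L4-lead RULING #7r).  All theorems; no definition, no new named fact; nothing here
bears on [IUTchIII] Cor. 3.12.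
-/

noncomputable section

open CategoryTheory
open scoped Classical

namespace Literature.AnabelianGeometry.AbsoluteAnabelian.AbsTopIII

open Literature.NumberTheory.DiophantineGeometry
open Literature.NumberTheory.DiophantineGeometry.AlgFunctionField

universe u

/-- **Thm. 1.9 (d) for every geometric system of every law-abiding model** (layers I–III), from
`Prop_1_8_i/ii`, `Prop_1_6_iii_units/ker`, `Prop_1_6_i`, `Rmk_1_5_4_i` BY NAME.
[cite: MochizukiAbsTopIII2015, Thm 1.9 (d) p.37] -/
theorem DescentKummerModel.thm19dTagged_of_facts (N : DescentKummerModel.{u}) (h18i : N.Prop_1_8_i)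
    (h18ii : N.Prop_1_8_ii) (h16u : N.Prop_1_6_iii_units) (h16k : N.Prop_1_6_iii_ker)
    (h16 : N.Prop_1_6_i) (h154 : Rmk_1_5_4_i.{u}) : N.Thm19dTagged := by
  intro Z hZ ι _ _ _ S T
  obtain ⟨Ω, _, ⟨T'⟩⟩ := N.exists_nfTower_of_tags S T hZ.isNFCurve
  have hinj : ∀ i : ι, Function.Injective (N.kummerToContainer S i) :=
    T'.kummerToContainer_injective hZ h16 h154
  have hff := T'.functionFieldPart_eq_nfRationalImage h18i h18ii h16u h16k h154 hZ
  have hcc := T'.constantPart_eq_nfConstantImage h18i h18ii h16u h16k h154 hZ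
  refine ⟨hinj, ⟨hff, ?_⟩, ⟨hcc, ?_⟩⟩
  · obtain ⟨e, he, hr⟩ := T'.exists_functionFieldEmbedding hinj
    exact ⟨e, he, hr.trans hff.symm⟩
  · obtain ⟨e, he, hr⟩ := T'.exists_constEmbedding hinj
    exact ⟨e, he, hr.trans hcc.symm⟩

end Literature.AnabelianGeometry.AbsoluteAnabelian.AbsTopIII
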